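import Literature.IUT.HodgeArakelov.FlTorsorStructureConj
import Literature.AnabelianGeometry.EtaleTheta.GalSectCor28iiCuspTransport
import Mathlib.GroupTheory.IndexNormal
import HarnessLib

/-!
# [IUTchII] Def 2.3 (iii)/(v): counting `±`-label classes of cusps — `|LabCusp^±(Π_⊆)|` as an INDEX, for a homogeneous cuspidal datum

S. Mochizuki, *Inter-universal Teichmüller theory II*, kurims manuscript (Dec. 2020), §2 Def 2.3 (iii) p. 68 («a `±`-label class of
cusps of `Π_⊆` … the set of `Π_⊆`-conjugacy classes of cuspidal inertia subgroups of `Π_⊆` whose commensurators in `Π_⊇` … such a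
set … is, in fact, of cardinality one»; «`LabCusp^±(Π_⊆)` … [a set of cardinality `l`]»), (v) p. 69 [claim: Mochizuki2012, status:
disputed] (IUTchII §2 Def 2.3 (iii), kurims p.68) (D-0012 claim key; record-only; nothing printed is asserted here).

abc-iut cell, seat abc-iut-w5-d132 (gen 6), row «DEF23V-CARD-L» (input (ii) «`|LabCusp^±(Π̂^±_v)| = l`» of abc-iut-w5-d243's Def 2.3 (v)
criterion `FlTorsorStructureConj.nonempty_iff_conjStable_card_ker`, p440082).  PROOF-ONLY, PURE GROUP THEORY over abc-iut-L6-t1's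
interface (`CuspidalInertiaData`, `labelRel`, `LabCuspPM`; no `def`, no instance, no named fact):

* `labelRel_refl` / `_symm` / `_trans` / `labelRel_equivalence` — Def 2.3 (iii)'s relation «normalisers `Π_⊇`-conjugate» IS an
  equivalence relation, so `LabCusp^±(Π_⊆) = Quot labelRel` identifies two cuspidal groups iff they are `labelRel`-related
  (`labCuspPM_mk_eq_mk_iff`);
* `normalizerMap_eq` — the normaliser-in-`Π_⊇` pushed into the ambient group is `N(J) ∩ Π_⊇`;
* **`card_labCuspPM_eq_index`** — for a HOMOGENEOUS datum at the hatted level (the cuspidal inertia groups of `Π̂^±_v` are exactly the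
  `Π̂^cor_v`-conjugates of one `J₀ ≤ Π̂^±_v` — the shape of the genuine tower's profinite datum, p432649, when `X_v` has one cusp):
  `|LabCusp^±(Π̂^±_v)| = [Π̂^cor_v : N(N(J₀) ∩ Π̂^±_v) · Π̂^±_v]` (orbit–stabiliser for the transitive conjugation action on label classes);
* **`card_labCuspPM_eq_l_of_inputs`** — the count `= l` from: `[Π̂^cor_v : Π̂^±_v] = 2l`, an index-`2` subgroup `Π̂_X ⊇ Π̂^±_v`, a subgroup
  `D ≤ Π̂^±_v` (the decomposition group of the cusp) with `D ≤ N(J₀)`, `N(J₀) ∩ Π̂_X ≤ D` (CUSP SEPARATION in the profinite completion: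
  the decomposition group is the normaliser of the inertia group, [AbsTopI] Lem 4.5 (vi) / [GalSect] Thm 1.3 (ii) — a HYPOTHESIS here),
  `J₀` conjugation-characteristic in `D`, and ONE element outside `Π̂_X` normalising `D` (the inversion of `C = X/±1` fixes the cusp).
  The two halves are separated: `≤ l`-direction = `two_le_relIndex` (needs only the inversion), `≥ l`-direction = the separation.

HONEST LABEL: kernel theorems about the typed interface; the anabelian inputs are explicit binders discharged / named elsewhere
(companion `LabelClassesOfCuspsCardGenuine.lean`).  No side taken on [IUTchIII] Cor 3.12; typed ≠ proved; nothing here asserts abc.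
-/

noncomputable section

open scoped Pointwise
open Literature.AnabelianGeometry.EtaleTheta (normalizer_conj_smul)

namespace Literature.IUT.HodgeArakelov

universe u

variable {S : BadPlaceSetting.{u}} {P : TopGroup.{u}} {T : TemperedCoverings S P} {W : PlusMinusTower T}

/-! ## 1. `labelRel` is an equivalence relation -/

section LabelRel

variable (C : CuspidalInertiaData W) (Qsub Qsup : Subgroup W.Corhat)

/-- `labelRel` is reflexive (witness `1 ∈ Π_⊇`). [claim: Mochizuki2012, status: disputed] (IUTchII §2 Def 2.3 (iii), kurims p.68) -/
theorem labelRel_refl (I : {I // C.IsCuspidalInertia Qsub I}) : labelRel C Qsub Qsup I I :=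
  ⟨1, Qsup.one_mem, (map_conj_one_eq_self _).symm⟩

/-- `labelRel` is symmetric (witness `g⁻¹`). [claim: Mochizuki2012, status: disputed] (IUTchII §2 Def 2.3 (iii), kurims p.68) -/
theorem labelRel_symm {I J : {I // C.IsCuspidalInertia Qsub I}} (h : labelRel C Qsub Qsup I J) :
    labelRel C Qsub Qsup J I := by
  obtain ⟨g, hg, hN⟩ := h
  refine ⟨g⁻¹, Qsup.inv_mem hg, ?_⟩
  rw [hN, ← map_conj_mul, inv_mul_cancel, map_conj_one_eq_self]

/-- `labelRel` is transitive (witness the product). [claim: Mochizuki2012, status: disputed] (IUTchII §2 Def 2.3 (iii), kurims p.68) -/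
theorem labelRel_trans {I J K : {I // C.IsCuspidalInertia Qsub I}} (h₁ : labelRel C Qsub Qsup I J)
    (h₂ : labelRel C Qsub Qsup J K) : labelRel C Qsub Qsup I K := by
  obtain ⟨g, hg, hN⟩ := h₁
  obtain ⟨h, hh, hN'⟩ := h₂
  refine ⟨h * g, Qsup.mul_mem hh hg, ?_⟩
  rw [hN', hN, ← map_conj_mul]

/-- **Def 2.3 (iii)'s relation «normalisers in `Π_⊇` are `Π_⊇`-conjugate» is an equivalence relation** on the cuspidal inertia subgroups
of `Π_⊆`. [claim: Mochizuki2012, status: disputed] (IUTchII §2 Def 2.3 (iii), kurims p.68) -/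
theorem labelRel_equivalence : Equivalence (labelRel C Qsub Qsup) :=
  ⟨labelRel_refl C Qsub Qsup, labelRel_symm C Qsub Qsup, labelRel_trans C Qsub Qsup⟩

/-- Two cuspidal inertia subgroups give the same `±`-label class iff they are `labelRel`-related (no equivalence closure needed).
[claim: Mochizuki2012, status: disputed] (IUTchII §2 Def 2.3 (iii), kurims p.68) -/
theorem labCuspPM_mk_eq_mk_iff (I J : {I // C.IsCuspidalInertia Qsub I}) :
    (Quot.mk _ I : LabCuspPM C Qsub Qsup) = Quot.mk _ J ↔ labelRel C Qsub Qsup I J :=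
  Quot.eq.trans (labelRel_equivalence C Qsub Qsup).eqvGen_iff

/-- The normaliser of `J ≤ Π_⊇` taken inside `Π_⊇` and pushed into the ambient `Π̂^cor_v` is `N(J) ∩ Π_⊇`.
[claim: Mochizuki2012, status: disputed] (IUTchII §2 Def 2.3 (iii), kurims p.68) -/
theorem normalizerMap_eq {J : Subgroup W.Corhat} (hJ : J ≤ Qsup) :
    (Subgroup.normalizer ((J.subgroupOf Qsup : Subgroup Qsup) : Set Qsup)).map Qsup.subtype =
      Subgroup.normalizer (J : Set W.Corhat) ⊓ Qsup := by
  rw [← Subgroup.subgroupOf_normalizer_eq hJ, Subgroup.subgroupOf_map_subtype]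

end LabelRel

/-! ## 2. Generic conjugation bookkeeping -/

section Generic

variable {G : Type*} [Group G]

/-- `g ∈ N(H)` iff `g H g⁻¹ = H` (pointwise spelling) (conjugation bookkeeping for Def 2.3 (iii)). [claim: Mochizuki2012, status: disputed] (IUTchII §2 Def 2.3 (iii), kurims p.68) -/
theorem mem_normalizer_iff_conj_smul_eq {H : Subgroup G} {g : G} :
    g ∈ Subgroup.normalizer (H : Set G) ↔ MulAut.conj g • H = H :=
  Subgroup.mem_normalizer_iff_map_conj_eq

/-- Membership in `N ⊔ P` for `P` normal: `x ∈ N ⊔ P ↔ ∃ p ∈ P, ∃ n ∈ N, x = p * n` (conjugation bookkeeping for Def 2.3 (iii)). [claim: Mochizuki2012, status: disputed] (IUTchII §2 Def 2.3 (iii), kurims p.68) -/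
theorem mem_sup_normal_iff {N Q : Subgroup G} [Q.Normal] {x : G} :
    x ∈ N ⊔ Q ↔ ∃ p ∈ Q, ∃ n ∈ N, x = p * n := by
  rw [← SetLike.mem_coe, sup_comm, Subgroup.normal_mul, Set.mem_mul]
  constructor
  · rintro ⟨p, hp, n, hn, rfl⟩
    exact ⟨p, hp, n, hn, rfl⟩
  · rintro ⟨p, hp, n, hn, rfl⟩
    exact ⟨p, hp, n, hn, rfl⟩

end Generic

/-! ## 3. The count for a homogeneous cuspidal datum at the hatted level -/

section Homogeneous

variable {C : CuspidalInertiaData W} {J₀ : Subgroup W.Corhat}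

/-- For a `Π̂^cor_v`-conjugate `q J₀ q⁻¹ ≤ Π̂^±_v` of `J₀ ≤ Π̂^±_v`: its normaliser in `Π̂^±_v` (pushed into `Π̂^cor_v`) is
`q · (N(J₀) ∩ Π̂^±_v) · q⁻¹` (`Π̂^±_v ⊴ Π̂^cor_v`). [claim: Mochizuki2012, status: disputed] (IUTchII §2 Def 2.3 (iii), kurims p.68) -/
theorem normalizerMap_conj_smul (hJ₀ : J₀ ≤ W.pmHat) (q : W.Corhat) :
    (Subgroup.normalizer ((((MulAut.conj q • J₀).subgroupOf W.pmHat : Subgroup W.pmHat)) : Set W.pmHat)).map W.pmHat.subtype =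
      MulAut.conj q • (Subgroup.normalizer (J₀ : Set W.Corhat) ⊓ W.pmHat) := by
  have hle : MulAut.conj q • J₀ ≤ W.pmHat :=
    (Subgroup.pointwise_smul_le_pointwise_smul_iff.mpr hJ₀).trans_eq (Subgroup.Normal.conj_smul_eq_self q W.pmHat)
  rw [normalizerMap_eq W.pmHat hle, normalizer_conj_smul, Subgroup.smul_inf, Subgroup.Normal.conj_smul_eq_self q W.pmHat]

/-- **The label relation between two conjugates of `J₀`, as a COSET condition**: `a J₀ a⁻¹ ~ b J₀ b⁻¹` iff
`a⁻¹ b ∈ N(N(J₀) ∩ Π̂^±_v) · Π̂^±_v`. [claim: Mochizuki2012, status: disputed] (IUTchII §2 Def 2.3 (iii), kurims p.68) -/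
theorem labelRel_conj_smul_iff (hJ₀ : J₀ ≤ W.pmHat) {a b : W.Corhat}
    (ha : C.IsCuspidalInertia W.pmHat (MulAut.conj a • J₀)) (hb : C.IsCuspidalInertia W.pmHat (MulAut.conj b • J₀)) :
    labelRel C W.pmHat W.pmHat ⟨_, ha⟩ ⟨_, hb⟩ ↔
      a⁻¹ * b ∈ Subgroup.normalizer ((Subgroup.normalizer (J₀ : Set W.Corhat) ⊓ W.pmHat : Subgroup W.Corhat) : Set W.Corhat) ⊔
        W.pmHat := by
  set N₀ : Subgroup W.Corhat := Subgroup.normalizer (J₀ : Set W.Corhat) ⊓ W.pmHat with hN₀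
  change (∃ g ∈ W.pmHat, _ = _) ↔ _
  simp only [normalizerMap_conj_smul hJ₀, ← conj_smul_eq_map_conj]
  rw [mem_sup_normal_iff]
  constructor
  · rintro ⟨g, hg, hN⟩
    -- `b N₀ b⁻¹ = (g a) N₀ (g a)⁻¹`, so `(g a)⁻¹ b ∈ N(N₀)`; and `a⁻¹ b = (a⁻¹ g a) · ((g a)⁻¹ b)`
    refine ⟨a⁻¹ * g * a, ?_, (g * a)⁻¹ * b, ?_, by group⟩
    · have := W.pmHat_normal.conj_mem g hg a⁻¹
      rwa [inv_inv] at this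
    · rw [mem_normalizer_iff_conj_smul_eq, map_mul, mul_smul, map_inv, inv_smul_eq_iff, hN, ← mul_smul, ← map_mul]
  · rintro ⟨p, hp, n, hn, hab⟩
    -- `b = a p n`; take `g := a p⁻¹ a⁻¹`... we need `b N₀ b⁻¹ = g a N₀ a⁻¹ g⁻¹` with `g ∈ Π̂^±_v`: `g := a p a⁻¹`
    refine ⟨a * p * a⁻¹, W.pmHat_normal.conj_mem p hp a, ?_⟩
    have hb' : b = a * p * a⁻¹ * a * n := by
      rw [inv_mul_cancel_right, mul_assoc, ← hab, mul_inv_cancel_left]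
    rw [mem_normalizer_iff_conj_smul_eq] at hn
    rw [hb', map_mul, mul_smul, hn, ← mul_smul, ← map_mul, inv_mul_cancel_right]

/-- **`|LabCusp^±(Π̂^±_v)|` AS AN INDEX** for a homogeneous hatted-level datum: if the cuspidal inertia subgroups of `Π̂^±_v` are
EXACTLY the `Π̂^cor_v`-conjugates of one `J₀ ≤ Π̂^±_v`, then `q ↦ ⟦q J₀ q⁻¹⟧` identifies `LabCusp^±(Π̂^±_v)` with the coset space
`Π̂^cor_v / (N(N(J₀) ∩ Π̂^±_v) · Π̂^±_v)`, so `|LabCusp^±(Π̂^±_v)| = [Π̂^cor_v : N(N(J₀) ∩ Π̂^±_v) · Π̂^±_v]`.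
[claim: Mochizuki2012, status: disputed] (IUTchII §2 Def 2.3 (iii), kurims p.68) -/
theorem card_labCuspPM_eq_index (hJ₀ : J₀ ≤ W.pmHat)
    (hC : ∀ J, C.IsCuspidalInertia W.pmHat J ↔ ∃ q : W.Corhat, J = MulAut.conj q • J₀) :
    Nat.card (LabCuspPM C W.pmHat W.pmHat) =
      (Subgroup.normalizer ((Subgroup.normalizer (J₀ : Set W.Corhat) ⊓ W.pmHat : Subgroup W.Corhat) : Set W.Corhat) ⊔
        W.pmHat).index := by
  set Sg : Subgroup W.Corhat :=
    Subgroup.normalizer ((Subgroup.normalizer (J₀ : Set W.Corhat) ⊓ W.pmHat : Subgroup W.Corhat) : Set W.Corhat) ⊔ W.pmHat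
    with hSg
  have hcusp : ∀ q : W.Corhat, C.IsCuspidalInertia W.pmHat (MulAut.conj q • J₀) := fun q => (hC _).mpr ⟨q, rfl⟩
  let f : W.Corhat → LabCuspPM C W.pmHat W.pmHat := fun q => Quot.mk _ ⟨MulAut.conj q • J₀, hcusp q⟩
  have hf : ∀ a b, f a = f b ↔ a⁻¹ * b ∈ Sg := fun a b =>
    (labCuspPM_mk_eq_mk_iff C W.pmHat W.pmHat _ _).trans (labelRel_conj_smul_iff hJ₀ (hcusp a) (hcusp b))
  have hfs : Function.Surjective f := by
    intro t
    induction t using Quot.ind with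
    | mk J =>
      obtain ⟨q, hq⟩ := (hC J.1).mp J.2
      exact ⟨q, congrArg (Quot.mk _) (Subtype.ext hq.symm)⟩
  -- descend `f` to the coset space
  let F : W.Corhat ⧸ Sg → LabCuspPM C W.pmHat W.pmHat := fun x =>
    Quotient.liftOn' x f fun a b hab => (hf a b).mpr (QuotientGroup.leftRel_apply.mp hab)
  have hF : ∀ q, F (QuotientGroup.mk q) = f q := fun _ => rfl
  have hFbij : Function.Bijective F := by
    constructor
    · intro x y hxy
      obtain ⟨a, rfl⟩ := QuotientGroup.mk_surjective x
      obtain ⟨b, rfl⟩ := QuotientGroup.mk_surjective y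
      rw [hF, hF, hf] at hxy
      exact QuotientGroup.eq.mpr hxy
    · intro t
      obtain ⟨q, rfl⟩ := hfs t
      exact ⟨QuotientGroup.mk q, hF q⟩
  rw [Subgroup.index_eq_card, Nat.card_congr (Equiv.ofBijective F hFbij)]

/-- **`[N(D) : N(D) ∩ Π̂_X] ≥ 2` from the inversion**: if some `q₁ ∉ Π̂_X` normalises `D`, the relative index of `Π̂_X` in `N(D)` is
not `1`. [claim: Mochizuki2012, status: disputed] (IUTchII §2 Def 2.3 (iii), kurims p.68) -/
theorem relIndex_normalizer_ne_one {Xh D : Subgroup W.Corhat} {q₁ : W.Corhat} (hq₁X : q₁ ∉ Xh)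
    (hq₁D : MulAut.conj q₁ • D = D) : Xh.relIndex (Subgroup.normalizer (D : Set W.Corhat)) ≠ 1 := by
  rw [Ne, Subgroup.relIndex_eq_one]
  exact fun h => hq₁X (h (mem_normalizer_iff_conj_smul_eq.mpr hq₁D))

/-- **THE COUNT `|LabCusp^±(Π̂^±_v)| = l` FROM ITS GROUP-THEORETIC INPUTS.**  Hatted-level homogeneous datum (cusps of `Π̂^±_v` = the
`Π̂^cor_v`-conjugates of `J₀`), `[Π̂^cor_v : Π̂^±_v] = 2l`, an index-`2` subgroup `Π̂_X ⊇ Π̂^±_v` of `Π̂^cor_v`, a subgroup `D ≤ Π̂^±_v`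
normalising `J₀` with (SEPARATION) `N(J₀) ∩ Π̂_X ≤ D` and `J₀` stable under every `q` normalising `D`, and an element `q₁ ∉ Π̂_X`
normalising `D`.  Then `N(J₀) ∩ Π̂^±_v = D`, the stabiliser of the class `⟦J₀⟧` is `N(D) · Π̂^±_v` with `[N(D) · Π̂^±_v : Π̂^±_v] = 2`,
and `|LabCusp^±(Π̂^±_v)| = 2l / 2 = l`. [claim: Mochizuki2012, status: disputed] (IUTchII §2 Def 2.3 (iii), kurims p.68) -/
theorem card_labCuspPM_eq_l_of_inputs (hJ₀ : J₀ ≤ W.pmHat)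
    (hC : ∀ J, C.IsCuspidalInertia W.pmHat J ↔ ∃ q : W.Corhat, J = MulAut.conj q • J₀)
    {Xh D : Subgroup W.Corhat} (hXh : Xh.index = 2) (hPX : W.pmHat ≤ Xh) (hDP : D ≤ W.pmHat)
    (hDJ : D ≤ Subgroup.normalizer (J₀ : Set W.Corhat)) (hsep : Subgroup.normalizer (J₀ : Set W.Corhat) ⊓ Xh ≤ D)
    (hJD : ∀ q : W.Corhat, MulAut.conj q • D = D → MulAut.conj q • J₀ = J₀)
    {q₁ : W.Corhat} (hq₁X : q₁ ∉ Xh) (hq₁D : MulAut.conj q₁ • D = D) (hidx : W.pmHat.index = 2 * S.l) :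
    Nat.card (LabCuspPM C W.pmHat W.pmHat) = S.l := by
  haveI : Xh.Normal := Subgroup.normal_of_index_eq_two hXh
  -- (1) `N(J₀) ∩ Π̂^±_v = D`
  have hN₀ : Subgroup.normalizer (J₀ : Set W.Corhat) ⊓ W.pmHat = D :=
    le_antisymm ((inf_le_inf_left _ hPX).trans hsep) (le_inf hDJ hDP)
  rw [card_labCuspPM_eq_index hJ₀ hC, hN₀]
  set N₂ : Subgroup W.Corhat := Subgroup.normalizer (D : Set W.Corhat) with hN₂
  -- (2) `N(D) ∩ Π̂_X ≤ Π̂^±_v`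
  have hN₂X : N₂ ⊓ Xh ≤ W.pmHat := by
    rintro q ⟨hqD, hqX⟩
    have hqJ : MulAut.conj q • J₀ = J₀ := hJD q (mem_normalizer_iff_conj_smul_eq.mp hqD)
    exact hDP (hsep ⟨mem_normalizer_iff_conj_smul_eq.mpr hqJ, hqX⟩)
  have hinf : W.pmHat ⊓ N₂ = Xh ⊓ N₂ :=
    le_antisymm (inf_le_inf_right _ hPX) (le_inf (fun q hq => hN₂X ⟨hq.2, hq.1⟩) inf_le_right)
  -- (3) `[N(D) · Π̂^±_v : Π̂^±_v] = [N(D) : N(D) ∩ Π̂_X] = 2`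
  have h2 : Xh.relIndex N₂ = 2 := by
    have hdvd : Xh.relIndex N₂ ∣ 2 := hXh ▸ Subgroup.relIndex_dvd_index_of_normal Xh N₂
    rcases (Nat.dvd_prime Nat.prime_two).mp hdvd with h1 | h2
    · exact absurd h1 (relIndex_normalizer_ne_one hq₁X hq₁D)
    · exact h2
  have hrel : W.pmHat.relIndex (N₂ ⊔ W.pmHat) = 2 := by
    rw [Subgroup.relIndex_sup_right, ← Subgroup.inf_relIndex_right, hinf, Subgroup.inf_relIndex_right, h2]
  -- (4) `2l = [Π̂^cor_v : Π̂^±_v] = [Π̂^cor_v : N(D) · Π̂^±_v] · 2`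
  have hmul := Subgroup.relIndex_mul_index (le_sup_right : W.pmHat ≤ N₂ ⊔ W.pmHat)
  rw [hrel, hidx] at hmul
  exact Nat.eq_of_mul_eq_mul_left two_pos hmul

/-- The `≤ l` HALF alone (no separation input): with the homogeneous datum, `[Π̂^cor_v : Π̂^±_v] = 2l`, `Π̂_X` of index `2` containing
`Π̂^±_v`, and ONE `q₁ ∉ Π̂_X` normalising `N(J₀) ∩ Π̂^±_v`, the number of `±`-label classes DIVIDES `l` (it is `2l / [N · Π̂^±_v : Π̂^±_v]` with
an even relative index). [claim: Mochizuki2012, status: disputed] (IUTchII §2 Def 2.3 (iii), kurims p.68) -/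
theorem card_labCuspPM_dvd_l (hJ₀ : J₀ ≤ W.pmHat)
    (hC : ∀ J, C.IsCuspidalInertia W.pmHat J ↔ ∃ q : W.Corhat, J = MulAut.conj q • J₀)
    {Xh : Subgroup W.Corhat} (hXh : Xh.index = 2) (hPX : W.pmHat ≤ Xh) {q₁ : W.Corhat} (hq₁X : q₁ ∉ Xh)
    (hq₁N : MulAut.conj q₁ • (Subgroup.normalizer (J₀ : Set W.Corhat) ⊓ W.pmHat) = Subgroup.normalizer (J₀ : Set W.Corhat) ⊓ W.pmHat)
    (hidx : W.pmHat.index = 2 * S.l) :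
    Nat.card (LabCuspPM C W.pmHat W.pmHat) ∣ S.l := by
  haveI : Xh.Normal := Subgroup.normal_of_index_eq_two hXh
  rw [card_labCuspPM_eq_index hJ₀ hC]
  set N₀ : Subgroup W.Corhat := Subgroup.normalizer (J₀ : Set W.Corhat) ⊓ W.pmHat with hN₀
  set N₂ : Subgroup W.Corhat := Subgroup.normalizer (N₀ : Set W.Corhat) with hN₂
  -- `[N₂ ⊔ Π̂^±_v : Π̂^±_v]` is divisible by `[N₂ ⊔ Π̂^±_v : (N₂ ⊔ Π̂^±_v) ∩ Π̂_X] = 2`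
  have hq₁ : q₁ ∈ N₂ ⊔ W.pmHat := Subgroup.mem_sup_left (mem_normalizer_iff_conj_smul_eq.mpr hq₁N)
  have hX2 : Xh.relIndex (N₂ ⊔ W.pmHat) = 2 := by
    have hdvd : Xh.relIndex (N₂ ⊔ W.pmHat) ∣ 2 := hXh ▸ Subgroup.relIndex_dvd_index_of_normal Xh _
    rcases (Nat.dvd_prime Nat.prime_two).mp hdvd with h1 | h2
    · exact absurd (Subgroup.relIndex_eq_one.mp h1 hq₁) hq₁X
    · exact h2
  have hdvd2 : 2 ∣ W.pmHat.relIndex (N₂ ⊔ W.pmHat) :=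
    hX2 ▸ Subgroup.relIndex_dvd_of_le_left (N₂ ⊔ W.pmHat) hPX
  obtain ⟨k, hk⟩ := hdvd2
  have hmul := Subgroup.relIndex_mul_index (le_sup_right : W.pmHat ≤ N₂ ⊔ W.pmHat)
  rw [hk, hidx, mul_assoc] at hmul
  exact Dvd.intro_left k (Nat.eq_of_mul_eq_mul_left two_pos hmul)

end Homogeneous

end Literature.IUT.HodgeArakelov

end
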